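import Summits.ABC.IUTFork.Repair.CandInternal2Real
import HarnessLib

/-!
# IUT REPAIR BRANCH (rung LADDER-ABC:A2.RP → A2.RESCUE-H), class (i) INTERNAL, sub-cell B0, seat rp-d2 — `CandInternal2RealLabels`: the
# TWO-SIDED LABEL WINDOW for the content of RP-I06⋆ («`q ∈ q^{j²}·𝓘`») at the REAL `p`-adic log-shell, and its form for a `2l`-th ROOT `q̲`

PROOF-ONLY file (D-0012; 0 definitions, 0 `Prop` facts) of the abc-iut cell, IUT REPAIR branch; seat abc-iut-rp-d2 gen 3 (D-0079 R-H
«numerics/kernel-eval» hand, abc-iut-rp-plan 13:23:48Z (5): the DECIDING LEMMAS for the cells of `plan/rescue-H/I06STAR-TABLE.tsv`).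
TAKES NO SIDE on [IUTchIII] Cor. 3.12 or on any author; classical `p`-adic analysis about the log-shell `ℐ_K = (p*)⁻¹·log_p(𝒪_K^×)` of
[AbsTopIII] Def. 5.4 (iii) (abc-iut-L4-t3 / L3-t11: `logShell (PadicLogOnUnits.ofUnitLog p K)`, `logShell_ofUnitLog`) over abc-iut-S1's
[IUTchIV] Prop. 1.2 (i) `p^{a_e}·𝒪_K ⊆ log_p(𝒪_K^×) ⊆ p^{−b_e}·𝒪_K` (`pBall_logRadiusA_subset_logUnits`, `logUnits_subset_pBall_neg_logRadiusB`;
`a_e = logRadiusA p e`, `b_e = logRadiusB p e`, `e` the absolute ramification index, `c := ord_p(p*) ∈ {1, 2}`); standard axioms.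

WHY. The B0 log-shell class's only hull-level supplier is RP-I05 ∧ RP-I06⋆, whose content at a bad place `v` and label `j` is the membership
`q_v ∈ q_v^{j²}·𝓘_v` (`CandInternal2NoGo.star_iff_price`: «(j²−1)·ord_v(q_v) ≤ log-shell index»). Gen 0/2 of this seat proved the NECESSITY
half at the real shell (`CandInternal2Real.norm_le_of_mem_pow_smul_logShell`: `q ∈ q^n·ℐ_K ⟹ ‖q‖ ≤ ‖q‖^n·‖p*‖⁻¹·p^{b_e}`) and the `e = 1`
negative (`not_mem_jsq_smul_logShell_of_unramified`). This file adds the SUFFICIENCY half from the LOWER inclusion of Prop. 1.2 (i) and states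
both in «height» form, so that a table cell can be CERTIFIED POSITIVE as well as negative, and records the form relevant to the INTENDED
q-pilot datum: by [IUTchII] Introduction (p. 2 l. 50, «let q̲_v be a 2l-th root of q_v») and [IUTchI] Ex. 3.2 (iv) the Kummer datum is a
`2l`-th ROOT `q̲` of the Tate parameter, so its `ℚ_p`-normalised valuation is `ord_p(q_E)/(2l)` — small against the shell exponents.

RESULTS (`K` complete, nontrivially ultrametric-normed over `ℚ_p`, `ProperSpace K`; `‖q‖ = p^{−h}`, `h ∈ ℝ`). §1 (any normed field)
`mem_pow_smul_of_norm_le`: `closedBall 0 r ⊆ I → q ≠ 0 → ‖q‖ ≤ ‖q‖^n·r → q ∈ q^n • I`. §2 `closedBall_radiusA_subset_logShell`: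
`closedBall 0 (‖p*‖⁻¹·p^{−a_e}) ⊆ ℐ_K`; **`mem_pow_smul_logShell_of_norm_le`** (sufficiency). §3 HEIGHT FORM — the window:
**`mem_pow_smul_logShell_of_height_le`**: `(n−1)·h ≤ c − a_e ⟹ q ∈ q^n·ℐ_K`; `height_le_of_mem_pow_smul_logShell`: `q ∈ q^n·ℐ_K ⟹ (n−1)·h ≤ b_e + c`;
`label_window` (both); `mem_pow_smul_logShell_iff_of_le`: for `p > 2`, `e ≤ p − 2` the window CLOSES — `q ∈ q^n·ℐ_K ⟺ (n−1)·h ≤ 1 − 1/e`.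
§4 ROOT FORM (`‖q̲‖^N = p^{−H}`, intended `N = 2l`, `H = ord_p(q_E)`): `mem_pow_smul_logShell_of_root`: `(n−1)·H ≤ N·(c − a_e) ⟹ q̲ ∈ q̲^n·ℐ_K`;
`root_height_le_of_mem_pow_smul_logShell`: `⟹ (n−1)·H ≤ N·(b_e + c)`; `jsq_root_window` (`n = j²`). §5 closed-form bounds for hand evaluation:
`logRadiusA_le` (`a_e ≤ 1/(p−2) + 1/e`, `p > 2`), `logRadiusA_three` (`p = 3`: `a_e = 1`, so `c − a_e = 0` — sufficiency certifies nothing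
beyond `𝒪_K ⊆ ℐ_K`), `logRadiusB_le`, `mem_pow_smul_logShell_of_height_le_explicit` (`p ≥ 5`: `(n−1)·h ≤ 1 − 1/(p−2) − 1/e` suffices).
READING FOR THE TABLE (neutral, arithmetic): with both columns `ord_w(q̲_v) = e_w·ord_p(q_E)/(2l)` and `d_w ∈ [e_w·(c − a_{e_w}), e_w·(b_{e_w} + c)]`
in `w`-normalised units, `slack_j = e_w·[κ_w − (j²−1)·ord_p(q_E)/(2l)]` with `κ_w ∈ [c − a, b + c]`: the ramification index cancels up to
`κ_w`, and the SIGN of the slack at label `j` is that of `2l·κ_w − (j²−1)·ord_p(q_E)` — certified `+` below `2l·(c − a_e)`, certified `−` above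
`2l·(b_e + c)`; at the top label `j = l⋇` the necessary side is `≈ (l/8)·ord_p(q_E) ≤ b_e + c`. No judgement on print; no side taken.
[claim: Mochizuki2012, status: disputed] for the quoted readings; [cite: MochizukiAbsTopIII2015, Def 5.4 (iii) p. 126].
-/

noncomputable section

namespace Summit.ABC.IUTFork.Repair.CandInternal2RealLabels

open Set Metric
open scoped Pointwise
open Literature.AnabelianGeometry.AbsoluteAnabelian Literature.IUT.LogThetaLattice Literature.IUT.LogVolume
  Summit.ABC.IUTFork.Repair.CandInternal2Real

/-! ## 1. Sufficiency in any normed field -/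

section NormedField

variable {K : Type*} [NormedField K]

/-- **CONVERSE HEIGHT BOUND.** If `I` contains the ball of radius `r`, `q ≠ 0` and `‖q‖ ≤ ‖q‖^n · r`, then `q ∈ q^n · I` (witness `ι = q^{1−n}`,
`‖ι‖ = ‖q‖^{1−n} ≤ r`). [folklore] -/
theorem mem_pow_smul_of_norm_le {q : K} {n : ℕ} {I : Set K} {r : ℝ} (hI : closedBall (0 : K) r ⊆ I) (hq : q ≠ 0)
    (h : ‖q‖ ≤ ‖q‖ ^ n * r) : q ∈ q ^ n • I := by
  refine Set.mem_smul_set.2 ⟨(q ^ n)⁻¹ * q, hI ?_, ?_⟩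
  · rw [mem_closedBall, dist_zero_right, norm_mul, norm_inv, norm_pow]
    have hpos : 0 < ‖q‖ ^ n := pow_pos (norm_pos_iff.2 hq) n
    rw [inv_mul_le_iff₀ hpos]
    exact h
  · rw [smul_eq_mul, ← mul_assoc, mul_inv_cancel₀ (pow_ne_zero n hq), one_mul]

/-- If `‖q‖^N = p^{−H}` (`N ≠ 0`) then `‖q‖ = p^{−H/N}` (the `ℚ_p`-valuation of an `N`-th root). [folklore] -/
theorem norm_eq_rpow_of_pow_eq (p : ℕ) {q : K} {N : ℕ} (hN : N ≠ 0) {H : ℝ} (hqN : ‖q‖ ^ N = (p : ℝ) ^ (-H)) :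
    ‖q‖ = (p : ℝ) ^ (-(H / N)) := by
  have hp0 : (0 : ℝ) ≤ p := by positivity
  rw [← Real.pow_rpow_inv_natCast (norm_nonneg q) hN, hqN, ← Real.rpow_mul hp0]
  congr 1
  ring

end NormedField

/-! ## 2. The lower radius of the real log-shell ([IUTchIV] Prop. 1.2 (i), lower inclusion) and SUFFICIENCY -/

section Real

variable (p : ℕ) [Fact p.Prime]
variable (K : Type*) [NontriviallyNormedField K] [NormedAlgebra ℚ_[p] K] [IsUltrametricDist K] [ProperSpace K]

omit [IsUltrametricDist K] [ProperSpace K] in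
/-- `‖p*‖ > 0` (`p* = p` or `4`). [cite: MochizukiAbsTopIII2015, Def 5.4 (iii) p. 126] -/
theorem norm_pstar_pos : 0 < ‖((p ^ (if p = 2 then 2 else 1) : ℕ) : K)‖ := by
  rw [norm_pstarNat_cast p K]
  have hp : (0 : ℝ) < p := by exact_mod_cast (Fact.out : p.Prime).pos
  positivity

omit [IsUltrametricDist K] [ProperSpace K] in
/-- `‖p*‖⁻¹ = p^{c}`, `c = ord_p(p*)`, as a real power. [cite: MochizukiAbsTopIII2015, Def 5.4 (iii) p. 126] -/
theorem norm_pstar_inv_eq_rpow :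
    (‖((p ^ (if p = 2 then 2 else 1) : ℕ) : K)‖⁻¹ : ℝ) = (p : ℝ) ^ (((if p = 2 then 2 else 1 : ℕ) : ℝ)) := by
  rw [norm_pstarNat_cast p K, inv_pow, inv_inv, Real.rpow_natCast]

/-- **LOWER RADIUS OF THE REAL LOG-SHELL**: `closedBall 0 (‖p*‖⁻¹ · p^{−a_e}) ⊆ ℐ_K` — from abc-iut-S1's [IUTchIV] Prop. 1.2 (i) lower inclusion
`p^{a_e}·𝒪_K ⊆ log_p(𝒪_K^×)` and `ℐ_K = (p*)⁻¹·log_p(𝒪_K^×)`. [cite: MochizukiAbsTopIII2015, Def 5.4 (iii) p. 126] [claim: Mochizuki2012, status: disputed] -/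
theorem closedBall_radiusA_subset_logShell :
    closedBall (0 : K) (‖((p ^ (if p = 2 then 2 else 1) : ℕ) : K)‖⁻¹ * (p : ℝ) ^ (-logRadiusA p (absRamificationIdx p K))) ⊆
      logShell (PadicLogOnUnits.ofUnitLog p K) := by
  intro x hx
  rw [mem_closedBall, dist_zero_right] at hx
  rw [logShell_ofUnitLog]
  have hps := norm_pstar_pos p K
  refine Set.mem_smul_set.2 ⟨((p ^ (if p = 2 then 2 else 1) : ℕ) : K) * x, ?_, ?_⟩
  · apply pBall_logRadiusA_subset_logUnits p K
    rw [mem_pBall_iff, norm_mul]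
    rwa [le_inv_mul_iff₀ hps] at hx
  · rw [smul_eq_mul, ← mul_assoc, inv_mul_cancel₀ (norm_pos_iff.1 hps), one_mul]

/-- **SUFFICIENCY at the real log-shell**: `‖q‖ ≤ ‖q‖^n · ‖p*‖⁻¹ · p^{−a_e}` ⟹ `q ∈ q^n · ℐ_K` — the converse companion of
`CandInternal2Real.norm_le_of_mem_pow_smul_logShell` (whose constant is `‖p*‖⁻¹ · p^{b_e}`). [cite: MochizukiAbsTopIII2015, Def 5.4 (iii) p. 126] -/
theorem mem_pow_smul_logShell_of_norm_le {q : K} (hq : q ≠ 0) {n : ℕ}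
    (h : ‖q‖ ≤ ‖q‖ ^ n * (‖((p ^ (if p = 2 then 2 else 1) : ℕ) : K)‖⁻¹ * (p : ℝ) ^ (-logRadiusA p (absRamificationIdx p K)))) :
    q ∈ q ^ n • logShell (PadicLogOnUnits.ofUnitLog p K) :=
  mem_pow_smul_of_norm_le (closedBall_radiusA_subset_logShell p K) hq h

/-! ## 3. HEIGHT FORM: the two-sided window `(n−1)·h ≤ c − a_e ⟹ q ∈ q^n·ℐ_K ⟹ (n−1)·h ≤ b_e + c` -/

/-- **WINDOW, lower edge (NEW)**: with `‖q‖ = p^{−h}`, `(n−1)·h ≤ c − a_e` ⟹ `q ∈ q^n · ℐ_K`. [cite: MochizukiAbsTopIII2015, Def 5.4 (iii) p. 126] -/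
theorem mem_pow_smul_logShell_of_height_le {q : K} (hq : q ≠ 0) {h : ℝ} (hqh : ‖q‖ = (p : ℝ) ^ (-h)) {n : ℕ}
    (hle : ((n : ℝ) - 1) * h ≤ ((if p = 2 then 2 else 1 : ℕ) : ℝ) - logRadiusA p (absRamificationIdx p K)) :
    q ∈ q ^ n • logShell (PadicLogOnUnits.ofUnitLog p K) := by
  apply mem_pow_smul_logShell_of_norm_le p K hq
  have hp1 : (1 : ℝ) < p := by exact_mod_cast (Fact.out : p.Prime).one_lt
  have hp0 : (0 : ℝ) < p := by linarith
  rw [norm_pstar_inv_eq_rpow p K, hqh, ← Real.rpow_natCast, ← Real.rpow_mul hp0.le, ← Real.rpow_add hp0, ← Real.rpow_add hp0,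
    Real.rpow_le_rpow_left_iff hp1]
  linarith

/-- **WINDOW, upper edge** (gen 2's `norm_le_of_mem_pow_smul_logShell` in height form): `q ∈ q^n · ℐ_K` ⟹ `(n−1)·h ≤ b_e + c`.
[cite: MochizukiAbsTopIII2015, Def 5.4 (iii) p. 126] -/
theorem height_le_of_mem_pow_smul_logShell {q : K} {h : ℝ} (hqh : ‖q‖ = (p : ℝ) ^ (-h)) {n : ℕ}
    (hmem : q ∈ q ^ n • logShell (PadicLogOnUnits.ofUnitLog p K)) :
    ((n : ℝ) - 1) * h ≤ logRadiusB p (absRamificationIdx p K) + ((if p = 2 then 2 else 1 : ℕ) : ℝ) := by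
  have hle := norm_le_of_mem_pow_smul_logShell p K hmem
  have hp1 : (1 : ℝ) < p := by exact_mod_cast (Fact.out : p.Prime).one_lt
  have hp0 : (0 : ℝ) < p := by linarith
  rw [norm_pstar_inv_eq_rpow p K, hqh, ← Real.rpow_natCast, ← Real.rpow_mul hp0.le, ← Real.rpow_add hp0, ← Real.rpow_add hp0,
    Real.rpow_le_rpow_left_iff hp1] at hle
  linarith

/-- **THE LABEL WINDOW** at one place: `(n−1)·h ≤ c − a_e ⟹ q ∈ q^n·ℐ_K ⟹ (n−1)·h ≤ b_e + c`. Between the two edges Prop. 1.2 (i) alone does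
not decide. [cite: MochizukiAbsTopIII2015, Def 5.4 (iii) p. 126] [claim: Mochizuki2012, status: disputed] -/
theorem label_window {q : K} (hq : q ≠ 0) {h : ℝ} (hqh : ‖q‖ = (p : ℝ) ^ (-h)) (n : ℕ) :
    (((n : ℝ) - 1) * h ≤ ((if p = 2 then 2 else 1 : ℕ) : ℝ) - logRadiusA p (absRamificationIdx p K) →
        q ∈ q ^ n • logShell (PadicLogOnUnits.ofUnitLog p K)) ∧
      (q ∈ q ^ n • logShell (PadicLogOnUnits.ofUnitLog p K) →
        ((n : ℝ) - 1) * h ≤ logRadiusB p (absRamificationIdx p K) + ((if p = 2 then 2 else 1 : ℕ) : ℝ)) :=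
  ⟨mem_pow_smul_logShell_of_height_le p K hq hqh, height_le_of_mem_pow_smul_logShell p K hqh⟩

/-- **THE WINDOW CLOSES for `p > 2`, `e ≤ p − 2`** (Prop. 1.2 (i) equality clause: `a_e = 1/e = −b_e`, `c = 1`): `q ∈ q^n · ℐ_K ⟺ (n−1)·h ≤ 1 − 1/e`.
[cite: MochizukiAbsTopIII2015, Def 5.4 (iii) p. 126] [claim: Mochizuki2012, status: disputed] -/
theorem mem_pow_smul_logShell_iff_of_le (hp : 2 < p) (he : absRamificationIdx p K ≤ p - 2) {q : K} (hq : q ≠ 0) {h : ℝ}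
    (hqh : ‖q‖ = (p : ℝ) ^ (-h)) (n : ℕ) :
    q ∈ q ^ n • logShell (PadicLogOnUnits.ofUnitLog p K) ↔ ((n : ℝ) - 1) * h ≤ 1 - 1 / (absRamificationIdx p K : ℝ) := by
  have he1 := absRamificationIdx_pos p K
  have ha := logRadiusA_eq hp he1 he
  have hb := logRadiusB_eq hp he1 he
  have hc : ((if p = 2 then 2 else 1 : ℕ) : ℝ) = 1 := by rw [if_neg (by omega)]; simp
  constructor
  · intro hmem
    have h1 := height_le_of_mem_pow_smul_logShell p K hqh hmem
    rw [hb, hc] at h1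
    linarith
  · intro hle
    apply mem_pow_smul_logShell_of_height_le p K hq hqh
    rw [ha, hc]
    linarith

/-! ## 4. ROOT FORM: the intended Kummer datum is a `2l`-th root `q̲` of the Tate parameter (`‖q̲‖^N = p^{−H}`, `N = 2l`, `H = ord_p(q_E)`) -/

/-- **ROOT FORM, lower edge**: `(n−1)·H ≤ N·(c − a_e)` ⟹ `q̲ ∈ q̲^n · ℐ_K` — for `N = 2l`, `n = j²`: «(j²−1)·ord_p(q_E) ≤ 2l·(c − a_e)» certifies
the content of RP-I06⋆ at the place and label. [claim: Mochizuki2012, status: disputed] [cite: MochizukiAbsTopIII2015, Def 5.4 (iii) p. 126] -/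
theorem mem_pow_smul_logShell_of_root {q : K} (hq : q ≠ 0) {N : ℕ} (hN : 0 < N) {H : ℝ} (hqN : ‖q‖ ^ N = (p : ℝ) ^ (-H)) {n : ℕ}
    (hle : ((n : ℝ) - 1) * H ≤ N * (((if p = 2 then 2 else 1 : ℕ) : ℝ) - logRadiusA p (absRamificationIdx p K))) :
    q ∈ q ^ n • logShell (PadicLogOnUnits.ofUnitLog p K) := by
  refine mem_pow_smul_logShell_of_height_le p K hq (norm_eq_rpow_of_pow_eq p (Nat.pos_iff_ne_zero.1 hN) hqN) ?_
  have hN' : (0 : ℝ) < N := by exact_mod_cast hN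
  rw [← mul_div_assoc, div_le_iff₀ hN']
  linarith

/-- **ROOT FORM, upper edge**: `q̲ ∈ q̲^n · ℐ_K` ⟹ `(n−1)·H ≤ N·(b_e + c)` — «(j²−1)·ord_p(q_E) ≤ 2l·(b_e + c)» is necessary.
[claim: Mochizuki2012, status: disputed] [cite: MochizukiAbsTopIII2015, Def 5.4 (iii) p. 126] -/
theorem root_height_le_of_mem_pow_smul_logShell {q : K} {N : ℕ} (hN : 0 < N) {H : ℝ} (hqN : ‖q‖ ^ N = (p : ℝ) ^ (-H)) {n : ℕ}
    (hmem : q ∈ q ^ n • logShell (PadicLogOnUnits.ofUnitLog p K)) :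
    ((n : ℝ) - 1) * H ≤ N * (logRadiusB p (absRamificationIdx p K) + ((if p = 2 then 2 else 1 : ℕ) : ℝ)) := by
  have h1 := height_le_of_mem_pow_smul_logShell p K (norm_eq_rpow_of_pow_eq p (Nat.pos_iff_ne_zero.1 hN) hqN) hmem
  have hN' : (0 : ℝ) < N := by exact_mod_cast hN
  rw [← mul_div_assoc, div_le_iff₀ hN'] at h1
  linarith

/-- **THE LABEL WINDOW FOR A `2l`-TH ROOT** (`q̲^{2l} = q_E` in norm, `‖q_E‖ = p^{−H}`), label `j`:
`(j²−1)·H ≤ 2l·(c − a_e) ⟹ q̲ ∈ q̲^{j²}·ℐ_K ⟹ (j²−1)·H ≤ 2l·(b_e + c)`. [claim: Mochizuki2012, status: disputed] -/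
theorem jsq_root_window {q : K} (hq : q ≠ 0) {l : ℕ} (hl : 0 < l) {H : ℝ} (hqN : ‖q‖ ^ (2 * l) = (p : ℝ) ^ (-H)) (j : ℕ) :
    ((((j ^ 2 : ℕ) : ℝ) - 1) * H ≤ ((2 * l : ℕ) : ℝ) * (((if p = 2 then 2 else 1 : ℕ) : ℝ) - logRadiusA p (absRamificationIdx p K)) →
        q ∈ q ^ (j ^ 2) • logShell (PadicLogOnUnits.ofUnitLog p K)) ∧
      (q ∈ q ^ (j ^ 2) • logShell (PadicLogOnUnits.ofUnitLog p K) →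
        (((j ^ 2 : ℕ) : ℝ) - 1) * H ≤ ((2 * l : ℕ) : ℝ) * (logRadiusB p (absRamificationIdx p K) + ((if p = 2 then 2 else 1 : ℕ) : ℝ))) :=
  ⟨mem_pow_smul_logShell_of_root p K hq (by omega) hqN, root_height_le_of_mem_pow_smul_logShell p K (by omega) hqN⟩

end Real

/-! ## 5. Closed-form bounds on the exponents, for hand evaluation of table cells -/

section Bounds

/-- `a_e ≤ 1/(p−2) + 1/e` for `p > 2`, `e ≥ 1` (`⌈x⌉ < x + 1`). [claim: Mochizuki2012, status: disputed] -/
theorem logRadiusA_le {p e : ℕ} (hp : 2 < p) (he : 1 ≤ e) : logRadiusA p e ≤ 1 / ((p : ℝ) - 2) + 1 / e := by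
  have hp2 : (0 : ℝ) < (p : ℝ) - 2 := by
    have : (2 : ℝ) < p := by exact_mod_cast hp
    linarith
  have he0 : (0 : ℝ) < e := by exact_mod_cast he
  rw [logRadiusA, if_neg (by omega)]
  have hceil : (⌈(e : ℝ) / ((p : ℝ) - 2)⌉ : ℝ) ≤ (e : ℝ) / ((p : ℝ) - 2) + 1 := (Int.ceil_lt_add_one _).le
  calc (⌈(e : ℝ) / ((p : ℝ) - 2)⌉ : ℝ) / e ≤ ((e : ℝ) / ((p : ℝ) - 2) + 1) / e := by gcongr
    _ = 1 / ((p : ℝ) - 2) + 1 / e := by field_simp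

/-- `p = 3`: `a_e = 1` (`⌈e/1⌉/e`), so `c − a_e = 0`: at places over `3` the lower edge certifies nothing beyond `𝒪_K ⊆ ℐ_K`.
[claim: Mochizuki2012, status: disputed] -/
theorem logRadiusA_three {e : ℕ} (he : 1 ≤ e) : logRadiusA 3 e = 1 := by
  have he0 : (e : ℝ) ≠ 0 := by exact_mod_cast (show e ≠ 0 by omega)
  rw [logRadiusA, if_neg (by norm_num)]
  have h1 : ((3 : ℕ) : ℝ) - 2 = 1 := by norm_num
  rw [h1, div_one, Int.ceil_natCast, Int.cast_natCast, div_self he0]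

/-- `b_e ≤ log(p·e/(p−1))/log p − 1/e` (`⌊x⌋ ≤ x`). [claim: Mochizuki2012, status: disputed] -/
theorem logRadiusB_le (p e : ℕ) : logRadiusB p e ≤ Real.log ((p : ℝ) * e / ((p : ℝ) - 1)) / Real.log p - 1 / e := by
  rw [logRadiusB]
  have := Int.floor_le (Real.log ((p : ℝ) * e / ((p : ℝ) - 1)) / Real.log p)
  linarith

variable (p : ℕ) [Fact p.Prime]
variable (K : Type*) [NontriviallyNormedField K] [NormedAlgebra ℚ_[p] K] [IsUltrametricDist K] [ProperSpace K]

/-- **EXPLICIT lower edge for odd `p`**: `(n−1)·h ≤ 1 − 1/(p−2) − 1/e` ⟹ `q ∈ q^n · ℐ_K` (`c = 1`, `a_e ≤ 1/(p−2) + 1/e`). For the intended `2l`-th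
root (`h = H/(2l)`): `(j²−1)·ord_p(q_E) ≤ 2l·(1 − 1/(p−2) − 1/e)` suffices at label `j`. [claim: Mochizuki2012, status: disputed] -/
theorem mem_pow_smul_logShell_of_height_le_explicit (hp : 2 < p) {q : K} (hq : q ≠ 0) {h : ℝ} (hqh : ‖q‖ = (p : ℝ) ^ (-h)) {n : ℕ}
    (hle : ((n : ℝ) - 1) * h ≤ 1 - 1 / ((p : ℝ) - 2) - 1 / (absRamificationIdx p K : ℝ)) :
    q ∈ q ^ n • logShell (PadicLogOnUnits.ofUnitLog p K) := by
  apply mem_pow_smul_logShell_of_height_le p K hq hqh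
  have ha := logRadiusA_le hp (absRamificationIdx_pos p K)
  have hc : ((if p = 2 then 2 else 1 : ℕ) : ℝ) = 1 := by rw [if_neg (by omega)]; simp
  rw [hc]
  linarith

end Bounds

end Summit.ABC.IUTFork.Repair.CandInternal2RealLabels

end
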